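import Mathlib
import Summits.NavierStokesRegularity.NavierStokesRegularity.Theorems.LerayQuarterDissipationFiniteDissipationLiouvilleVorticityAmplitudeJointBudget
import HarnessLib

/-!
# Crux `FiniteDissipationLiouville` (stmt-NavierStokesRegularity-22144): the `L³`-VORTICITY
# parameter of the finite-dissipation stratum — tools (file 1/3: scale invariance of the
# `L³`-vorticity law, the budget under a four-term stretching bound for `R ≥ 1`, scalar endgame)

Theorems file of route `LerayQuarterDissipation` (lead prover g16; `--supports` the crux; portrait
fact for the registered stub `stub_envelopeCriticalLiouville` of skeleton `Lines/birth.lean`).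
Navier–Stokes regularity is NOT proved by anything here; no summit is.

`𝒟_{C,K}`: Type-I ancient mild fields `V` in the KNSS gauge (`IsTypeIAncientMild C V`) whose slices
obey the quarter-rate dissipation law `∫ ‖DV(t)‖² ≤ K/√(−t)`. Next to the velocity constant
`C = sup √(−t)‖V‖` (`L^∞`), the dissipation constant `K = sup √(−t)∫‖DV(t)‖²` (an `L²`-norm of the
vorticity level) and the vorticity amplitude `C_ω = sup (−t)‖curl V‖` (`L^∞` of the vorticity,
`…VorticityAmplitude`, lead g15), the stratum carries the intermediate scale-invariant parameter
  `V₃ = sup_{t<0} √(−t) ‖curl V(t)‖_{L³(ℝ³)}`,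
in similarity variables `sup_s ‖Ω(s)‖_{L³}` (`Ω = lerayVorticity V = curl (lerayOrbit V)`,
`Ω(s,y) = (−t)ω(t, √(−t)y)`, `∫‖Ω(s)‖³ = (√(−t))³ ∫‖ω(t)‖³`). This file supplies the tools for the
explicit rung in that parameter (file 3/3 `…VorticityLThree`):

* `integrable_cube_norm_lerayVorticity` — SCALE INVARIANCE: the physical law
  `∫⁻ ‖curl V(t)‖ₑ³ ≤ v³/(√(−t))³` gives `‖Ω(s)‖³ ∈ L¹` and `∫‖Ω(s)‖³ ≤ v³` for every `s`;
* `integral_sq_norm_lerayVorticity_le_of_forall_one_le` — the squared-cutoff similarity-enstrophy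
  budget under a four-term stretching bound `2·str_R ≤ 2D_R + aZ_R + bZ_∞ + (c/R)I_{2R}` assumed only
  for `R ≥ 1` (lead g15's `…_of_forall_le'` asks it for all `R > 0`; the proof reads `R ≥ 1` only):
  a uniform bound `Z_∞ ≤ m` on the ancient orbit improves to `2(a+b)m`;
* `two_mul_le_add_of_le_sqrt_mul_sqrt` — the scalar AM–GM endgame
  `S ≤ √P√Q, P ≤ P', Q ≤ kB ⇒ 2S ≤ ηB + (k/η)P'`.

HONEST FRAMING. Bookkeeping about a HYPOTHETICAL class; nothing here bears on Navier–Stokes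
regularity or blow-up; nothing is removed from the catalogued DSS wall (`TypeIDSSLiouville`).

References: Koch–Nadirashvili–Seregin–Šverák, Acta Math. 203 (2009) §4–§6 (class, gauge);
Leray 1934 §20 (scaling); folklore energy method.
-/

noncomputable section

set_option linter.dupNamespace false

namespace Summit.NavierStokesRegularity.NavierStokesRegularity.Theorems.FiniteDissipationLiouville.VorticityLThree

open MeasureTheory Set Filter Topology Metric InnerProductSpace Function Real
open scoped RealInnerProductSpace ContDiff ENNReal Laplacian
open Literature.Analysis Literature.Analysis.FluidPDE
open Summit.NavierStokesRegularity.NavierStokesRegularity.Theorems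
open Summit.NavierStokesRegularity.NavierStokesRegularity.Theorems.GaussianGap
open Summit.NavierStokesRegularity.NavierStokesRegularity.Theorems.SimilarityEnstrophy
open Summit.NavierStokesRegularity.NavierStokesRegularity.Theorems.SmallDissipationGap
open Summit.NavierStokesRegularity.NavierStokesRegularity.Theorems.FiniteDissipationLiouville.VorticityAmplitude

variable {C : ℝ} {V : ℝ → (EuclideanSpace ℝ (Fin 3)) → (EuclideanSpace ℝ (Fin 3))}

/-! ### Cubes of norms: Bochner versus lower Lebesgue integral -/

section Cube

/-- A continuous field with `∫⁻ ‖f‖ₑ³ < ∞` has integrable `‖f‖³`. [folklore] -/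
theorem integrable_cube_norm_of_lintegral_lt_top {f : EuclideanSpace ℝ (Fin 3) → EuclideanSpace ℝ (Fin 3)}
    (hf : Continuous f) (h : ∫⁻ x, ‖f x‖ₑ ^ 3 < ⊤) : Integrable fun x => ‖f x‖ ^ 3 := by
  refine ⟨(hf.norm.pow 3).aestronglyMeasurable, ?_⟩
  refine (hasFiniteIntegral_iff_enorm).2 (lt_of_le_of_lt (le_of_eq ?_) h)
  refine lintegral_congr fun x => ?_
  rw [Real.enorm_eq_ofReal (pow_nonneg (norm_nonneg _) 3), ← ofReal_norm,
    ENNReal.ofReal_pow (norm_nonneg _)]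

/-- `ofReal (∫ ‖f‖³) = ∫⁻ ‖f‖ₑ³` for integrable `‖f‖³`. [folklore] -/
theorem ofReal_integral_cube_norm {f : EuclideanSpace ℝ (Fin 3) → EuclideanSpace ℝ (Fin 3)}
    (hf : Integrable fun x => ‖f x‖ ^ 3) :
    ENNReal.ofReal (∫ x, ‖f x‖ ^ 3) = ∫⁻ x, ‖f x‖ₑ ^ 3 := by
  rw [ofReal_integral_eq_lintegral_ofReal hf (ae_of_all _ fun x => pow_nonneg (norm_nonneg _) 3)]
  refine lintegral_congr fun x => ?_
  rw [← ofReal_norm, ENNReal.ofReal_pow (norm_nonneg _)]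

end Cube

/-! ### Scale invariance of the `L³`-vorticity law -/

section Scaling

/-- **Scale invariance of the `L³`-vorticity law.** If the physical vorticity obeys
`∫⁻ ‖curl V(t)‖ₑ³ ≤ v³/(√(−t))³` for all `t < 0` (i.e. `√(−t)‖curl V(t)‖_{L³} ≤ v`, `v ≥ 0`), then
every similarity vorticity slice `Ω(s) = lerayVorticity V s` has `‖Ω(s)‖³ ∈ L¹` with
`∫ ‖Ω(s)‖³ ≤ v³`: `Ω(s)(y) = e^{−s} curl V(t)(e^{−s/2}y)`, `t = −e^{−s}`, and
`∫ ‖curl V(t)(e^{−s/2}y)‖³ dy = e^{3s/2} ∫‖curl V(t)‖³`. [folklore; Leray 1934 §20 (scaling)] -/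
theorem integrable_cube_norm_lerayVorticity (hV : IsTypeIAncientMild C V) {v : ℝ} (hv : 0 ≤ v)
    (hω : ∀ t : ℝ, t < 0 → ∫⁻ x, ‖curl (V t) x‖ₑ ^ 3 ≤ ENNReal.ofReal (v ^ 3 / Real.sqrt (-t) ^ 3))
    (s : ℝ) :
    Integrable (fun y => ‖lerayVorticity V s y‖ ^ 3) ∧
      ∫ y, ‖lerayVorticity V s y‖ ^ 3 ≤ v ^ 3 := by
  set t : ℝ := -Real.exp (-s) with htdef
  set c : ℝ := Real.exp (-s / 2) with hcdef
  have ht : t < 0 := neg_neg_of_pos (Real.exp_pos _)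
  have hc : 0 < c := Real.exp_pos _
  have hsqrt : Real.sqrt (-t) = c := by rw [htdef, neg_neg, sqrt_exp_neg]
  -- the physical slice
  have h1 : ContDiff ℝ 1 (V t) := (hV.contDiff_slice ht).of_le (by norm_cast)
  have hcont : Continuous (curl (V t)) := by
    rw [curl_eq_curlCLM_comp]
    exact curlCLM.continuous.comp (h1.continuous_fderiv one_ne_zero)
  have hbd : ∫⁻ x, ‖curl (V t) x‖ₑ ^ 3 ≤ ENNReal.ofReal (v ^ 3 / c ^ 3) := by
    rw [← hsqrt]; exact hω t ht
  have hintV : Integrable fun x => ‖curl (V t) x‖ ^ 3 :=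
    integrable_cube_norm_of_lintegral_lt_top hcont (lt_of_le_of_lt hbd ENNReal.ofReal_lt_top)
  have hvalV : ∫ x, ‖curl (V t) x‖ ^ 3 ≤ v ^ 3 / c ^ 3 := by
    refine (ENNReal.ofReal_le_ofReal_iff (by positivity)).1 ?_
    rw [ofReal_integral_cube_norm hintV]
    exact hbd
  -- the similarity slice
  have hrepr : ∀ y, ‖lerayVorticity V s y‖ ^ 3 =
      Real.exp (-s) ^ 3 * ‖curl (V t) (c • y)‖ ^ 3 := by
    intro y
    rw [lerayVorticity_apply, curl_lerayOrbit, norm_smul, Real.norm_of_nonneg (Real.exp_pos _).le,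
      mul_pow]
  have hfun : (fun y => ‖lerayVorticity V s y‖ ^ 3) =
      fun y => Real.exp (-s) ^ 3 * (fun x => ‖curl (V t) x‖ ^ 3) (c • y) := funext hrepr
  have hintc : Integrable fun y => (fun x => ‖curl (V t) x‖ ^ 3) (c • y) :=
    (integrable_comp_smul_iff (volume : Measure (EuclideanSpace ℝ (Fin 3)))
      (fun x => ‖curl (V t) x‖ ^ 3) hc.ne').2 hintV
  refine ⟨by rw [hfun]; exact hintc.const_mul _, ?_⟩
  have hsc : (∫ y, (fun x => ‖curl (V t) x‖ ^ 3) (c • y)) =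
      |(c ^ 3)⁻¹| • ∫ x, ‖curl (V t) x‖ ^ 3 := by
    have h := Measure.integral_comp_smul (volume : Measure (EuclideanSpace ℝ (Fin 3)))
      (fun x => ‖curl (V t) x‖ ^ 3) c
    rw [finrank_euclideanSpace_fin] at h
    exact h
  rw [hfun, integral_const_mul, hsc, smul_eq_mul, abs_of_nonneg (by positivity)]
  have hc3 : Real.exp (-s) ^ 3 * (c ^ 3)⁻¹ = c ^ 3 := by
    have e2 : Real.exp (-s) = c * c := by rw [hcdef, ← Real.exp_add]; congr 1; ring
    rw [e2]; field_simp
  calc Real.exp (-s) ^ 3 * ((c ^ 3)⁻¹ * ∫ x, ‖curl (V t) x‖ ^ 3)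
      = c ^ 3 * ∫ x, ‖curl (V t) x‖ ^ 3 := by rw [← mul_assoc, hc3]
    _ ≤ c ^ 3 * (v ^ 3 / c ^ 3) := mul_le_mul_of_nonneg_left hvalV (pow_nonneg hc.le 3)
    _ = v ^ 3 := by field_simp

end Scaling

/-! ### Scalar endgame -/

section Scalar

/-- **AM–GM endgame** (pure real arithmetic). From `S ≤ √P·√Q`, `0 ≤ P ≤ P'`, `Q ≤ k·B` with
`k, B ≥ 0` and a weight `η > 0`: `2S ≤ ηB + (k/η)P'`
(`η·2√P'√(kB) ≤ kP' + η²B` is `(√(kP') − η√B)² ≥ 0`). [folklore] -/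
theorem two_mul_le_add_of_le_sqrt_mul_sqrt {S P Q P' k B η : ℝ} (hS : S ≤ Real.sqrt P * Real.sqrt Q)
    (hP0 : 0 ≤ P) (hP : P ≤ P') (hQ : Q ≤ k * B) (hk : 0 ≤ k) (hB : 0 ≤ B) (hη : 0 < η) :
    2 * S ≤ η * B + k / η * P' := by
  have hP'0 : 0 ≤ P' := hP0.trans hP
  have h1 : S ≤ Real.sqrt P' * Real.sqrt (k * B) :=
    hS.trans (mul_le_mul (Real.sqrt_le_sqrt hP) (Real.sqrt_le_sqrt hQ) (Real.sqrt_nonneg _)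
      (Real.sqrt_nonneg _))
  have hprod : Real.sqrt P' * Real.sqrt (k * B) = Real.sqrt (k * P') * Real.sqrt B := by
    rw [← Real.sqrt_mul hP'0, ← Real.sqrt_mul (mul_nonneg hk hP'0)]
    congr 1; ring
  have hsq : 0 ≤ (Real.sqrt (k * P') - η * Real.sqrt B) ^ 2 := sq_nonneg _
  have e1 : Real.sqrt (k * P') ^ 2 = k * P' := Real.sq_sqrt (mul_nonneg hk hP'0)
  have e2 : Real.sqrt B ^ 2 = B := Real.sq_sqrt hB
  have h2 : η * (2 * (Real.sqrt P' * Real.sqrt (k * B))) ≤ k * P' + η ^ 2 * B := by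
    rw [hprod]
    nlinarith [hsq, e1, e2]
  have h3 : 2 * (Real.sqrt P' * Real.sqrt (k * B)) ≤ η * B + k / η * P' := by
    rw [show η * B + k / η * P' = (k * P' + η ^ 2 * B) / η by field_simp; ring]
    rw [le_div_iff₀ hη]
    linarith
  linarith

end Scalar

/-! ### The budget under a four-term stretching bound assumed for `R ≥ 1` -/

section Budget

/-- **One turn of the screw, dissipation used, stretching bound for `R ≥ 1` only.** Let
`V ∈ 𝒟_{C,K}` satisfy, for all `σ` and all `R ≥ 1`,
`2∫φ_R²⟪DUΩ,Ω⟫ ≤ 2∫φ_R²|∇Ω|²_F + a Z_R + b Z_∞ + (c/R)∫_{B̄_{2R}}‖Ω‖²` (`a, b, c ≥ 0`), and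
`Z_∞(σ) ≤ m` for all `σ`. Then `Z_∞(s) ≤ 2(a+b)m` for all `s`: the squared-cutoff enstrophy identity
(`deriv_sqCutoffEnstrophy_eq`) with the drift flux signed, transport and viscous fluxes priced by the
collar mass, the dissipation cancelling the first term of the stretching bound, gives
`Z_R' ≤ −½Z_R + (a+b)m + LM/R` for `R ≥ 1`; the backward ODE bound for the ANCIENT orbit
(`le_div_of_deriv_le_neg_mul_add`) and `R → ∞` conclude. Verbatim lead g15's
`integral_sq_norm_lerayVorticity_le_of_forall_le'` (which assumes the bound for all `R > 0` but
reads it only for `R ≥ 1`); needed because the `L³`-pricing of the stretching term carries a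
collar term `(c₁/R)²`, dominated by `c₁²/R` only for `R ≥ 1`. [folklore energy method] -/
theorem integral_sq_norm_lerayVorticity_le_of_forall_one_le (hV : IsTypeIAncientMild C V) {K : ℝ}
    (hK : ∀ t : ℝ, t < 0 → ∫⁻ x, ‖fderiv ℝ (V t) x‖ₑ ^ 2 ≤ ENNReal.ofReal (K / Real.sqrt (-t)))
    {a b c : ℝ} (ha : 0 ≤ a) (hb : 0 ≤ b) (hc : 0 ≤ c)
    (hstr : ∀ σ : ℝ, ∀ R : ℝ, 1 ≤ R →
      2 * (∫ y, smoothTransition (2 - ‖y‖ ^ 2 / R ^ 2) ^ 2 *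
        ⟪fderiv ℝ (lerayOrbit V σ) y (lerayVorticity V σ y), lerayVorticity V σ y⟫) ≤
        2 * (∫ y, smoothTransition (2 - ‖y‖ ^ 2 / R ^ 2) ^ 2 *
            frobeniusNormSq (fderiv ℝ (lerayVorticity V σ) y)) +
          a * (∫ y, smoothTransition (2 - ‖y‖ ^ 2 / R ^ 2) ^ 2 * ‖lerayVorticity V σ y‖ ^ 2) +
          b * (∫ y, ‖lerayVorticity V σ y‖ ^ 2) +
          c / R * ∫ y in closedBall (0 : EuclideanSpace ℝ (Fin 3)) (2 * R), ‖lerayVorticity V σ y‖ ^ 2)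
    {m : ℝ} (hm : ∀ s, ∫ y, ‖lerayVorticity V s y‖ ^ 2 ≤ m) (s : ℝ) :
    ∫ y, ‖lerayVorticity V s y‖ ^ 2 ≤ 2 * (a + b) * m := by
  obtain ⟨c₁, hc₁0, hc₁⟩ :=
    exists_norm_fderiv_smoothTransition_cutoff_le (E := (EuclideanSpace ℝ (Fin 3)))
  obtain ⟨c₂, hc₂0, hc₂⟩ :=
    exists_abs_laplacian_smoothTransition_cutoff_le (E := (EuclideanSpace ℝ (Fin 3)))
  have hC : 0 ≤ C := hV.nonneg
  have hΩi := fun σ => integrable_sq_norm_lerayVorticity hV hK σ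
  set M : ℝ := ‖curlCLM‖ ^ 2 * max K 0 with hMdef
  have hM0 : 0 ≤ M := by positivity
  have hm0 : 0 ≤ m := (integral_nonneg fun y => sq_nonneg _).trans (hm s)
  set L : ℝ := 2 * C * c₁ + 2 * c₂ + 6 * c₁ ^ 2 + c with hLdef
  have hL0 : 0 ≤ L := by positivity
  -- Step 1
  have hZ : ∀ R : ℝ, 1 ≤ R → ∀ σ : ℝ,
      (∫ y, smoothTransition (2 - ‖y‖ ^ 2 / R ^ 2) ^ 2 * ‖lerayVorticity V σ y‖ ^ 2) ≤
        ((a + b) * m + L / R * M) / (1 / 2) := by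
    intro R hR1
    have hR : 0 < R := lt_of_lt_of_le one_pos hR1
    have hd : Differentiable ℝ fun σ =>
        ∫ y, smoothTransition (2 - ‖y‖ ^ 2 / R ^ 2) ^ 2 * ‖lerayVorticity V σ y‖ ^ 2 :=
      fun σ => (hasDerivAt_sqCutoffEnstrophy hV hR σ).differentiableAt
    have hle' : ∀ σ, (∫ y, smoothTransition (2 - ‖y‖ ^ 2 / R ^ 2) ^ 2 * ‖lerayVorticity V σ y‖ ^ 2) ≤
        ∫ y, ‖lerayVorticity V σ y‖ ^ 2 := by
      intro σ
      refine integral_mono_of_nonneg (Eventually.of_forall fun y =>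
        mul_nonneg (sq_nonneg _) (sq_nonneg _)) (hΩi σ).1 (Eventually.of_forall fun y => ?_)
      have h1 := sqCutoff_le_one R y
      have h0 : 0 ≤ ‖lerayVorticity V σ y‖ ^ 2 := sq_nonneg _
      nlinarith
    have hle : ∀ σ, (∫ y, smoothTransition (2 - ‖y‖ ^ 2 / R ^ 2) ^ 2 * ‖lerayVorticity V σ y‖ ^ 2) ≤ M :=
      fun σ => (hle' σ).trans (hΩi σ).2
    have hI : ∀ σ, (∫ y in closedBall (0 : EuclideanSpace ℝ (Fin 3)) (2 * R), ‖lerayVorticity V σ y‖ ^ 2) ≤ M :=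
      fun σ => (setIntegral_le_integral (hΩi σ).1 (Eventually.of_forall fun y => sq_nonneg _)).trans (hΩi σ).2
    have hZ' : ∀ σ, deriv (fun σ' =>
        ∫ y, smoothTransition (2 - ‖y‖ ^ 2 / R ^ 2) ^ 2 * ‖lerayVorticity V σ' y‖ ^ 2) σ ≤
        -(1 / 2) * (∫ y, smoothTransition (2 - ‖y‖ ^ 2 / R ^ 2) ^ 2 * ‖lerayVorticity V σ y‖ ^ 2) +
          ((a + b) * m + L / R * M) := by
      intro σ
      rw [deriv_sqCutoffEnstrophy_eq hV hR σ]
      set φ : (EuclideanSpace ℝ (Fin 3)) → ℝ := fun z => smoothTransition (2 - ‖z‖ ^ 2 / R ^ 2) with hφdef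
      set Ω := lerayVorticity V σ with hΩdef
      set U := lerayOrbit V σ with hUdef
      set I : ℝ := ∫ y in closedBall (0 : (EuclideanSpace ℝ (Fin 3))) (2 * R), ‖Ω y‖ ^ 2 with hIdef
      set Z : ℝ := ∫ y, φ y ^ 2 * ‖Ω y‖ ^ 2 with hZdef
      have hI0 : 0 ≤ I := integral_nonneg fun y => sq_nonneg _
      have hIM : I ≤ M := hI σ
      have hZ0 : 0 ≤ Z := integral_nonneg fun y => mul_nonneg (sq_nonneg _) (sq_nonneg _)
      have hZm : Z ≤ m := (hle' σ).trans (hm σ)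
      have hΩ1 : ContDiff ℝ 1 Ω := signedBudget_contDiff_lerayVorticity_slice hV σ (n := 1)
      have hcΩ : Continuous Ω := hΩ1.continuous
      have hUC : ∀ y, ‖U y‖ ≤ C := fun y => norm_lerayOrbit_le_of_typeI hV σ y
      have hw1 : ContDiff ℝ 1 fun z : (EuclideanSpace ℝ (Fin 3)) => φ z ^ 2 := contDiff_sqCutoff (n := 1) R
      have hw2 : ContDiff ℝ 2 fun z : (EuclideanSpace ℝ (Fin 3)) => φ z ^ 2 := contDiff_sqCutoff (n := 2) R
      have hcDw : Continuous (fderiv ℝ fun z : (EuclideanSpace ℝ (Fin 3)) => φ z ^ 2) :=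
        hw1.continuous_fderiv one_ne_zero
      have hDrift : (∫ y, fderiv ℝ (fun z : (EuclideanSpace ℝ (Fin 3)) => φ z ^ 2) y y * ‖Ω y‖ ^ 2) ≤ 0 :=
        integral_nonpos fun y => mul_nonpos_iff.2 (Or.inr ⟨fderiv_sqCutoff_self_nonpos R y, sq_nonneg _⟩)
      have hT : |∫ y, fderiv ℝ (fun z : (EuclideanSpace ℝ (Fin 3)) => φ z ^ 2) y (U y) * ‖Ω y‖ ^ 2| ≤
          C * (2 * (c₁ / R)) * I := by
        refine abs_integral_le_of_weight_sq hcΩ (w := fun y => C * ‖fderiv ℝ (fun z : (EuclideanSpace ℝ (Fin 3)) => φ z ^ 2) y‖)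
          (continuous_const.mul hcDw.norm) (fun y hy => ?_) (fun y _ => ?_) (fun y => ?_)
        · show C * ‖fderiv ℝ (fun z : (EuclideanSpace ℝ (Fin 3)) => φ z ^ 2) y‖ = 0
          rw [hφdef, fderiv_sqCutoff_eq_zero hR hy, norm_zero, mul_zero]
        · exact mul_le_mul_of_nonneg_left (norm_fderiv_sqCutoff_le hc₁ hR y) hC
        · rw [abs_mul, abs_of_nonneg (sq_nonneg ‖Ω y‖)]
          have e1 : |fderiv ℝ (fun z : (EuclideanSpace ℝ (Fin 3)) => φ z ^ 2) y (U y)| ≤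
              ‖fderiv ℝ (fun z : (EuclideanSpace ℝ (Fin 3)) => φ z ^ 2) y‖ * C := by
            rw [← Real.norm_eq_abs]
            exact (ContinuousLinearMap.le_opNorm _ _).trans
              (mul_le_mul_of_nonneg_left (hUC y) (norm_nonneg _))
          calc |fderiv ℝ (fun z : (EuclideanSpace ℝ (Fin 3)) => φ z ^ 2) y (U y)| * ‖Ω y‖ ^ 2
              ≤ (‖fderiv ℝ (fun z : (EuclideanSpace ℝ (Fin 3)) => φ z ^ 2) y‖ * C) * ‖Ω y‖ ^ 2 :=
                mul_le_mul_of_nonneg_right e1 (sq_nonneg _)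
            _ = C * ‖fderiv ℝ (fun z : (EuclideanSpace ℝ (Fin 3)) => φ z ^ 2) y‖ * ‖Ω y‖ ^ 2 := by ring
      have hVisc : |∫ y, ‖Ω y‖ ^ 2 * (Δ (fun z : (EuclideanSpace ℝ (Fin 3)) => φ z ^ 2)) y| ≤
          (2 * (c₂ / R ^ 2) + 6 * (c₁ / R) ^ 2) * I := by
        refine abs_integral_le_of_weight_sq hcΩ (w := fun y => |(Δ (fun z : (EuclideanSpace ℝ (Fin 3)) => φ z ^ 2)) y|)
          (continuous_laplacian hw2).abs (fun y hy => ?_) (fun y _ => ?_) (fun y => ?_)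
        · show |(Δ (fun z : (EuclideanSpace ℝ (Fin 3)) => φ z ^ 2)) y| = 0
          rw [hφdef, laplacian_sqCutoff_eq_zero hR hy, abs_zero]
        · exact abs_laplacian_sqCutoff_le hc₁ hc₂ hR y
        · rw [abs_mul, abs_of_nonneg (sq_nonneg ‖Ω y‖), mul_comm]
      -- stretching by hypothesis
      have hS := hstr σ R hR1
      have hSa : a * Z ≤ a * m := mul_le_mul_of_nonneg_left hZm ha
      have hSb : b * ∫ y, ‖lerayVorticity V σ y‖ ^ 2 ≤ b * m := mul_le_mul_of_nonneg_left (hm σ) hb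
      have hSc : c / R * I ≤ c / R * M := mul_le_mul_of_nonneg_left hIM (div_nonneg hc hR.le)
      -- absorption
      have hT' := (le_abs_self _).trans hT
      have hVisc' := (le_abs_self _).trans hVisc
      have hR2 : 1 / R ^ 2 ≤ 1 / R := by
        rw [div_le_div_iff₀ (by positivity) hR]
        nlinarith
      have hc₂R : c₂ / R ^ 2 ≤ c₂ / R := by
        have := mul_le_mul_of_nonneg_left hR2 hc₂0
        simpa only [mul_one_div] using this
      have hc₁R : (c₁ / R) ^ 2 ≤ c₁ ^ 2 / R := by
        rw [div_pow]
        have := mul_le_mul_of_nonneg_left hR2 (sq_nonneg c₁)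
        simpa only [mul_one_div] using this
      have a1 : C * (2 * (c₁ / R)) * I ≤ C * (2 * (c₁ / R)) * M :=
        mul_le_mul_of_nonneg_left hIM (by positivity)
      have a2 : (2 * (c₂ / R ^ 2) + 6 * (c₁ / R) ^ 2) * I ≤ (2 * (c₂ / R) + 6 * (c₁ ^ 2 / R)) * M :=
        (mul_le_mul_of_nonneg_right (by linarith [hc₂R, hc₁R]) hI0).trans
          (mul_le_mul_of_nonneg_left hIM (by positivity))
      have e : L / R * M =
          C * (2 * (c₁ / R)) * M + (2 * (c₂ / R) + 6 * (c₁ ^ 2 / R)) * M + c / R * M := by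
        rw [hLdef]; field_simp; ring
      rw [e]
      linarith [hDrift, hT', hVisc', hS, hSa, hSb, hSc, a1, a2]
    exact le_div_of_deriv_le_neg_mul_add hd ⟨M, hle⟩ (by norm_num : (0:ℝ) < 1 / 2) hZ'
  -- Step 2: balls
  have hcΩ : Continuous (lerayVorticity V s) :=
    (signedBudget_contDiff_lerayVorticity_slice hV s (n := 1)).continuous
  have hball : ∀ n : ℕ, 1 ≤ (n : ℝ) →
      (∫ y in closedBall (0 : EuclideanSpace ℝ (Fin 3)) n, ‖lerayVorticity V s y‖ ^ 2) ≤
        ((a + b) * m + L / n * M) / (1 / 2) := by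
    intro n hn
    have hR : 0 < (n : ℝ) := lt_of_lt_of_le one_pos hn
    refine le_trans ?_ (hZ n hn s)
    have hint : Integrable fun y => smoothTransition (2 - ‖y‖ ^ 2 / (n : ℝ) ^ 2) ^ 2 *
        ‖lerayVorticity V s y‖ ^ 2 :=
      (((contDiff_sqCutoff (n := 1) (n : ℝ)).continuous).mul (hcΩ.norm.pow 2)).integrable_of_hasCompactSupport
        ((hasCompactSupport_sqCutoff hR).mul_right)
    calc (∫ y in closedBall (0 : EuclideanSpace ℝ (Fin 3)) n, ‖lerayVorticity V s y‖ ^ 2)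
        = ∫ y in closedBall (0 : EuclideanSpace ℝ (Fin 3)) n,
            smoothTransition (2 - ‖y‖ ^ 2 / (n : ℝ) ^ 2) ^ 2 * ‖lerayVorticity V s y‖ ^ 2 := by
          refine setIntegral_congr_fun measurableSet_closedBall fun y hy => ?_
          rw [mem_closedBall, dist_zero_right] at hy
          rw [sqCutoff_eq_one hR hy, one_mul]
      _ ≤ ∫ y, smoothTransition (2 - ‖y‖ ^ 2 / (n : ℝ) ^ 2) ^ 2 * ‖lerayVorticity V s y‖ ^ 2 :=
          setIntegral_le_integral hint (Eventually.of_forall fun y =>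
            mul_nonneg (sq_nonneg _) (sq_nonneg _))
  have hlim : Tendsto (fun n : ℕ =>
      ∫ y in closedBall (0 : EuclideanSpace ℝ (Fin 3)) n, ‖lerayVorticity V s y‖ ^ 2) atTop
      (𝓝 (∫ y, ‖lerayVorticity V s y‖ ^ 2)) := by
    have h := tendsto_setIntegral_of_monotone (μ := (volume : Measure (EuclideanSpace ℝ (Fin 3))))
      (s := fun n : ℕ => closedBall (0 : EuclideanSpace ℝ (Fin 3)) n)
      (f := fun y => ‖lerayVorticity V s y‖ ^ 2) (fun n => measurableSet_closedBall)
      (fun m n hmn => closedBall_subset_closedBall (by exact_mod_cast hmn))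
      (by rw [iUnion_closedBall_nat]; exact (hΩi s).1.integrableOn)
    rwa [iUnion_closedBall_nat, Measure.restrict_univ] at h
  have hlim0 : Tendsto (fun n : ℕ => ((a + b) * m + L / n * M) / (1 / 2)) atTop
      (𝓝 (((a + b) * m + 0 * M) / (1 / 2))) :=
    (((tendsto_const_div_atTop_nhds_zero_nat L).mul_const M).const_add _).div_const _
  have hE := le_of_tendsto_of_tendsto hlim hlim0 (Filter.eventually_atTop.2 ⟨1, fun n hn => hball n
      (by exact_mod_cast hn)⟩)
  have e : ((a + b) * m + 0 * M) / (1 / 2) = 2 * (a + b) * m := by ring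
  rwa [e] at hE

end Budget

/-! ## Appendix (lead g16, same session): pointwise kinematics and two scalar facts for file 2/3 -/

section Appendix

/-- Trace-free stretching inequality, squared form: `div U(y) = 0` ⇒
`⟪DU(y)Ω,Ω⟫² ≤ ((2|DU(y)|²_F − ‖curl U(y)‖²)/3)(‖Ω‖²)²` (`three_mul_sq_inner_apply_le`). [folklore] -/
theorem sq_inner_fderiv_apply_le {U : (EuclideanSpace ℝ (Fin 3)) → (EuclideanSpace ℝ (Fin 3))}
    {y : EuclideanSpace ℝ (Fin 3)} (hdiv : VectorCalculus.divergence U y = 0)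
    (Ω : EuclideanSpace ℝ (Fin 3)) :
    ⟪fderiv ℝ U y Ω, Ω⟫ ^ 2 ≤
      (2 * frobeniusNormSq (fderiv ℝ U y) - ‖curl U y‖ ^ 2) / 3 * (‖Ω‖ ^ 2) ^ 2 := by
  have htr : ∑ i, fderiv ℝ U y ((EuclideanSpace.basisFun (Fin 3) ℝ) i) i = 0 := by
    rw [← traceCLM_eq_sum_coord, ← divergence_eq_traceCLM]; exact hdiv
  have h3 := three_mul_sq_inner_apply_le (fderiv ℝ U y) htr Ω
  rw [curl_eq_curlCLM, show (‖Ω‖ ^ 2) ^ 2 = ‖Ω‖ ^ 4 by ring]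
  linarith

/-- Linear form: `⟪DU(y)Ω,Ω⟫ ≤ σ(y)‖Ω‖²`, `σ = √((2|DU|²_F − ‖curl U‖²)/3)` (`div U(y) = 0`). [folklore] -/
theorem inner_fderiv_apply_le_sqrt_mul {U : (EuclideanSpace ℝ (Fin 3)) → (EuclideanSpace ℝ (Fin 3))}
    {y : EuclideanSpace ℝ (Fin 3)} (hdiv : VectorCalculus.divergence U y = 0)
    (Ω : EuclideanSpace ℝ (Fin 3)) :
    ⟪fderiv ℝ U y Ω, Ω⟫ ≤
      Real.sqrt ((2 * frobeniusNormSq (fderiv ℝ U y) - ‖curl U y‖ ^ 2) / 3) * ‖Ω‖ ^ 2 := by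
  have hX0 : 0 ≤ (2 * frobeniusNormSq (fderiv ℝ U y) - ‖curl U y‖ ^ 2) / 3 := by
    rw [curl_eq_curlCLM]; exact div_nonneg (two_mul_frobeniusNormSq_sub_nonneg _) (by norm_num)
  refine abs_le_of_sq_le_sq' ?_ (mul_nonneg (Real.sqrt_nonneg _) (sq_nonneg _)) |>.2
  rw [mul_pow, Real.sq_sqrt hX0]
  exact sq_inner_fderiv_apply_le hdiv Ω

/-- `(c/R)² ≤ c²/R` for `R ≥ 1`. [folklore] -/
theorem div_sq_le_sq_div_of_one_le (c : ℝ) {R : ℝ} (hR1 : 1 ≤ R) : (c / R) ^ 2 ≤ c ^ 2 / R := by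
  rw [div_pow]
  exact div_le_div_of_nonneg_left (sq_nonneg c) (lt_of_lt_of_le one_pos hR1) (by nlinarith)

/-- The coefficient bookkeeping of the `L³`-priced stretching bound: with `η = 2/(1+δ)`,
`η((1+δ)D + (1+δ⁻¹)J) = 2D + (2/δ)J` and `(k/η)(Z/3) = ((1+δ)k/6)Z`. [folklore] -/
theorem weight_bookkeeping {δ : ℝ} (hδ : 0 < δ) (D J k Z : ℝ) :
    2 / (1 + δ) * ((1 + δ) * D + (1 + δ⁻¹) * J) = 2 * D + 2 / δ * J ∧
      k / (2 / (1 + δ)) * (Z / 3) = (1 + δ) * k / 6 * Z := by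
  have hδ1 : (1 + δ) ≠ 0 := by positivity
  have hδ0 : δ ≠ 0 := hδ.ne'
  constructor <;> (field_simp; ring)

end Appendix

end Summit.NavierStokesRegularity.NavierStokesRegularity.Theorems.FiniteDissipationLiouville.VorticityLThree

end
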